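import Summits.RiemannHypothesis.RiemannHypothesis.Theorems.SuzukiThetaFlowUniformWindows

/-!
# SuzukiThetaFlowOpNormDecay — the θ-flow decay law at the OPERATOR-NORM level (column DBR; RH-FREE)

LINE 1 — LABEL: RH-FREE theorems about the explicit operator family `𝖪_θ[t]` ([Su20] (1.4)); bears_on: B-P(P2-flow)
(provisional id, fallback B-P(P2)).  WHAT THIS IS NOT: not a positivity statement about `ζ` (no sign of `ε(t)` is
asserted), not evidence for or against RH; the `∀ t` antitone level is Weil's criterion re-indexed (RH-EQUIVALENT,
declared by the card `theta-flow-weil-window`, NOT claimed); nothing here is progress toward RH.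

The decay law `Theorems.SuzukiThetaFlow.thetaFlowDecay` is stated per datum `f ∈ L²(−t,t)`; here it is read off at the
level the DBR column certifies (DATA.md §ET1e: `σ₁(θ,t) = ‖𝖪_θ[t]‖`), in the tree's hypothesis style
(`SuzukiWindowsDoorTempleWindow`: ANY bounded `A` on `L²(−t,t)` with the a.e. kernel formula for `K_θ`; one exists by
`exists_winOp`):

* `norm_sq_apply_eq_winNormSq` — `‖A φ‖² = winNormSq (limKernel θ) t φ` for every `φ ∈ L²(−t,t)`;
* **`opNorm_decay`** — for `t > 0`, `1 < θ₀ ≤ θ₁`: `‖𝖪_{θ₁}[t]‖ ≤ exp(−ε(t)(θ₁−θ₀)) · ‖𝖪_{θ₀}[t]‖` (the shape of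
  ET1e's Q-C6′ reading `σ₁(θ,t) ≲ e^{−θ ε(t)}`, now a theorem with the anchor `θ₀` explicit);
* **`opNorm_antitone_of_le_one`** — for `0 < t ≤ 1`: `‖𝖪_{θ₁}[t]‖ ≤ ‖𝖪_{θ₀}[t]‖` UNCONDITIONALLY (Weil input = the tree
  theorem `weilPositivityOn_one`): ET1e's Q-T1 rows with `t ≤ 1` (θ-antitone `σ₁`, 81/81 certified) are instances of a
  kernel theorem; the rows with `t > 1` remain RH-IMPLIED checks.

References: [Su20] M. Suzuki, ASPM 84 (2020) = arXiv:1907.07302, (1.4); E. Bombieri, Rend. Lincei (9) 11 (2000) §4.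
-/

noncomputable section

-- D-0017: `Summit.<S>.<S>.…` is the designed namespace of a single-problem summit.
set_option linter.dupNamespace false

open MeasureTheory Set

namespace Summit.RiemannHypothesis.RiemannHypothesis.Theorems.SuzukiThetaFlow

open Literature.NumberTheory.LFunctions
open Summit.RiemannHypothesis.RiemannHypothesis.Theorems.SuzukiWindowsDoorTempleGalerkin

variable {t : ℝ}

/-- RH-FREE.  For ANY bounded realisation `A` of `𝖪_θ[t]` on `L²(−t,t)` and every `φ ∈ L²(−t,t)`:
`‖Aφ‖² = winNormSq (limKernel θ) t φ` (the card's quadratic form at the representative `φ`). -/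
theorem norm_sq_apply_eq_winNormSq {θ : ℝ}
    {A : Lp ℝ 2 (volume.restrict (Ioo (-t) t)) →L[ℝ] Lp ℝ 2 (volume.restrict (Ioo (-t) t))}
    (hA : ∀ φ, (A φ : ℝ → ℝ) =ᵐ[volume.restrict (Ioo (-t) t)] fun x => ∫ y in Ioo (-t) t, limKernel θ (x + y) * φ y)
    (φ : Lp ℝ 2 (volume.restrict (Ioo (-t) t))) :
    ‖A φ‖ ^ 2 = winNormSq (limKernel θ) t φ := by
  have hφ : MemLp (φ : ℝ → ℝ) 2 (volume.restrict (Ioo (-t) t)) := Lp.memLp φ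
  have h := norm_winOp_toLp_sq hA hφ
  rw [Lp.toLp_coeFn φ hφ] at h
  exact h

/-- **RH-FREE · THE DECAY LAW AT THE OPERATOR-NORM LEVEL**: for `t > 0`, `1 < θ₀ ≤ θ₁` and any bounded realisations
`A₀` of `𝖪_{θ₀}[t]`, `A₁` of `𝖪_{θ₁}[t]` on `L²(−t,t)`: `‖A₁‖ ≤ exp(−ε(t)(θ₁−θ₀)) · ‖A₀‖`.  No sign of `ε(t)` is
asserted; nothing here bears on RH. -/
theorem opNorm_decay {θ₀ θ₁ : ℝ} (ht : 0 < t) (hθ₀ : 1 < θ₀) (hθ₀₁ : θ₀ ≤ θ₁)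
    {A₀ A₁ : Lp ℝ 2 (volume.restrict (Ioo (-t) t)) →L[ℝ] Lp ℝ 2 (volume.restrict (Ioo (-t) t))}
    (hA₀ : ∀ φ, (A₀ φ : ℝ → ℝ) =ᵐ[volume.restrict (Ioo (-t) t)] fun x => ∫ y in Ioo (-t) t, limKernel θ₀ (x + y) * φ y)
    (hA₁ : ∀ φ, (A₁ φ : ℝ → ℝ) =ᵐ[volume.restrict (Ioo (-t) t)] fun x => ∫ y in Ioo (-t) t, limKernel θ₁ (x + y) * φ y) :
    ‖A₁‖ ≤ Real.exp (-weilGroundEnergy t * (θ₁ - θ₀)) * ‖A₀‖ := by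
  refine ContinuousLinearMap.opNorm_le_bound _ (by positivity) fun φ => ?_
  have hφ : MemLp (φ : ℝ → ℝ) 2 (winMeasure t) := Lp.memLp φ
  have h1 : ‖A₁ φ‖ ^ 2 = winNormSq (limKernel θ₁) t φ := norm_sq_apply_eq_winNormSq hA₁ φ
  have h0 : ‖A₀ φ‖ ^ 2 = winNormSq (limKernel θ₀) t φ := norm_sq_apply_eq_winNormSq hA₀ φ
  have hd := thetaFlowDecay t ht θ₀ θ₁ hθ₀ hθ₀₁ φ hφ
  have hA₀φ : ‖A₀ φ‖ ≤ ‖A₀‖ * ‖φ‖ := A₀.le_opNorm φ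
  have hexp : Real.exp (-2 * weilGroundEnergy t * (θ₁ - θ₀)) =
      Real.exp (-weilGroundEnergy t * (θ₁ - θ₀)) ^ 2 := by
    rw [← Real.exp_nat_mul]; congr 1; push_cast; ring
  have hsq : ‖A₁ φ‖ ^ 2 ≤ (Real.exp (-weilGroundEnergy t * (θ₁ - θ₀)) * ‖A₀‖ * ‖φ‖) ^ 2 := by
    calc ‖A₁ φ‖ ^ 2 = winNormSq (limKernel θ₁) t φ := h1
      _ ≤ Real.exp (-2 * weilGroundEnergy t * (θ₁ - θ₀)) * winNormSq (limKernel θ₀) t φ := hd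
      _ = Real.exp (-weilGroundEnergy t * (θ₁ - θ₀)) ^ 2 * ‖A₀ φ‖ ^ 2 := by rw [hexp, h0]
      _ ≤ Real.exp (-weilGroundEnergy t * (θ₁ - θ₀)) ^ 2 * (‖A₀‖ * ‖φ‖) ^ 2 :=
          mul_le_mul_of_nonneg_left (pow_le_pow_left₀ (norm_nonneg _) hA₀φ 2) (sq_nonneg _)
      _ = (Real.exp (-weilGroundEnergy t * (θ₁ - θ₀)) * ‖A₀‖ * ‖φ‖) ^ 2 := by ring
  exact (pow_le_pow_iff_left₀ (norm_nonneg _) (by positivity) two_ne_zero).1 hsq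

/-- **RH-FREE · UNCONDITIONAL θ-ANTITONE OPERATOR NORMS ON COLUMN 2's WINDOW**: for `0 < t ≤ 1`, `1 < θ₀ ≤ θ₁` and any
bounded realisations `A₀` of `𝖪_{θ₀}[t]`, `A₁` of `𝖪_{θ₁}[t]`: `‖A₁‖ ≤ ‖A₀‖` (Weil input = the tree theorem
`weilPositivityOn_one`, so `ε(t) ≥ 0`).  A finite-window fact about explicit operators; nothing here bears on RH. -/
theorem opNorm_antitone_of_le_one {θ₀ θ₁ : ℝ} (ht : 0 < t) (ht1 : t ≤ 1) (hθ₀ : 1 < θ₀) (hθ₀₁ : θ₀ ≤ θ₁)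
    {A₀ A₁ : Lp ℝ 2 (volume.restrict (Ioo (-t) t)) →L[ℝ] Lp ℝ 2 (volume.restrict (Ioo (-t) t))}
    (hA₀ : ∀ φ, (A₀ φ : ℝ → ℝ) =ᵐ[volume.restrict (Ioo (-t) t)] fun x => ∫ y in Ioo (-t) t, limKernel θ₀ (x + y) * φ y)
    (hA₁ : ∀ φ, (A₁ φ : ℝ → ℝ) =ᵐ[volume.restrict (Ioo (-t) t)] fun x => ∫ y in Ioo (-t) t, limKernel θ₁ (x + y) * φ y) :
    ‖A₁‖ ≤ ‖A₀‖ := by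
  have hε : 0 ≤ weilGroundEnergy t := (weilGroundEnergy_nonneg_iff_holds ht).2 (WeilPositivityOn.mono ht1
    Summit.RiemannHypothesis.RiemannHypothesis.Theorems.WeilFormatCData.A1.weilPositivityOn_one)
  have hfac : Real.exp (-weilGroundEnergy t * (θ₁ - θ₀)) ≤ 1 := by
    apply Real.exp_le_one_iff.2
    have : 0 ≤ θ₁ - θ₀ := sub_nonneg.2 hθ₀₁
    nlinarith
  calc ‖A₁‖ ≤ Real.exp (-weilGroundEnergy t * (θ₁ - θ₀)) * ‖A₀‖ := opNorm_decay ht hθ₀ hθ₀₁ hA₀ hA₁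
    _ ≤ 1 * ‖A₀‖ := mul_le_mul_of_nonneg_right hfac (norm_nonneg _)
    _ = ‖A₀‖ := one_mul _

end Summit.RiemannHypothesis.RiemannHypothesis.Theorems.SuzukiThetaFlow

end
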